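import Summits.BirchSwinnertonDyer.BirchSwinnertonDyer.Theorems.KolyvaginRoadThreeZhangInductionOnPosOddStart
import Summits.BirchSwinnertonDyer.BirchSwinnertonDyer.Theorems.KolyvaginRoadThreeMethod2LevelSystems
import Summits.BirchSwinnertonDyer.BirchSwinnertonDyer.Theorems.KolyvaginRoadThreeMethod2Eigen
import Summits.BirchSwinnertonDyer.BirchSwinnertonDyer.Theorems.KolyvaginRoadThreeMethod2TowerCut
import Mathlib.GroupTheory.OrderOfElement
import HarnessLib

/-!
# Route `KolyvaginRoadThree`, deciding crux `ZhangSharpFrameAtThreeHL` (item stmt-BirchSwinnertonDyer-19574):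
# the S2-ENGINE stub of the v3 re-line (zhang3-p1 g8, `stub_inductionOfLevelSystemsAtThree`: a level Kolyvagin system +
# (A1) + odd Selmer rank `≥ 3` ⟹ a non-zero Kolyvagin class) REDUCED to ONE input — Zhang's Lemma 8.4 triangulation
# for the system's classes at good even NON-EMPTY levels; everything else (the induction, (A2), (A4), (A5), parity,
# the witness) is PROVED here
# (cell `bsd-stepL`, OWNER seat `bsd-stepL-koly` g14; `--supports stmt-BirchSwinnertonDyer-19574`, helper)

HONEST FRAMING. A CONDITIONAL reduction: the single hypothesis `hT` is the triangulation shape (A3) for the classes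
of a `Method2.LevelKolyvaginSystem` (zhang3-p1 g8, `Theorems/KolyvaginRoadThreeMethod2LevelSystems.lean` p496874) at
every good even non-empty level carrying a non-zero class; the conclusion is the TEXT of the proposed stub S2-ENGINE
`stub_inductionOfLevelSystemsAtThree` of `HOME/zhang3/skel/Lines-method3-19574.lean` VERBATIM. No definition, no named
fact, no `sorry` (the route file enters the import cone only through `Method2TowerCut`, for `kolSupp_prod`). Nothing is booked; the crux is NOT claimed. PARTITION: O2@3 (B10) × A1 ×
crux 19574 × stub S2 — none (composition; closes nothing; T7).

WHAT IS PROVED. Given `hT` (Lemma 8.4 (1)+(3) for `S.κ(·, n)` at good even non-empty `n`: `∃ s d, dim SelQ_n^s = d+1 ∧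
SelQ_n^s = SelRelQ_{n,B}^s ∧ SelRelQ_{n,B}^{¬s}` finite of `dim ≤ d`, `B` the base locus of `S.κ(·, n)`), W. Zhang's
induction runs in the kernel on the system: engine `ZhangInductionOnPosOddStart.exists_ne_zero_at_bottom_…` (koly g14
p495914: (A3) only at NON-EMPTY levels, (A2)/(A5) only at EVEN levels, parity only at the start) with (A1) = the
hypothesis of the stub (stub A's body, LANDED p489918), (A2) = the system's `transport` field, (A3) = `hT`, (A4) =
`relaxation_le`, (A5) = vacuous at `∅` (rank `≥ 3`) and the system's `baseCase` above it, odd start = the oddness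
hypothesis read in `SelQ ∅` currency (`finrank_selmer_eq_finrank_selQ_add`, which needs `c² = 1` — automatic for
`c ≠ 1` in a quadratic field); the non-zero bottom class `S.κ m ∅` is, by `realisation`, the mod-3 Kolyvagin class of a
Kolyvagin–Heegner datum of conductor `∏m`, which has Kolyvagin-prime support (`Method2TowerCut.kolSupp_prod`). So the ONLY thing
between the v3 skeleton's S2-ENGINE and the kernel is the model-side instantiation of koly3b's
`ZhangTriangulation.triangulation_finite` (p481938 ∕ zhang3-p1 p493507): membership dictionaries for `SelQ` ∕
`SelRelQ`, (REC), isotropies, (Perf) ∕ (Line) at Kolyvagin primes, (Cheb) ×2, (Supply) (koly3b g4) — exactly the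
hypothesis `hT`, which is also v2z-koly's stub T read on level systems.

References: [cite: WZhang2014, §9 proof of Thm. 9.1, Thm. 9.2, Lemma 8.4, Thm. 4.3, Thm. 7.2] [cite: GrossLMS1991, §3–§4].
-/

noncomputable section

open scoped Classical

namespace Summit.BirchSwinnertonDyer.Rank1Residual.X11b.Three.Koly.Method2EngineOfTriangulation

open WeierstrassCurve NumberField IsDedekindDomain
  Literature.NumberTheory.EllipticCurves Literature.NumberTheory.EllipticCurves.ModularForms
  Literature.NumberTheory.GaloisRepresentations Module

open Summit.BirchSwinnertonDyer.Rank1Residual.X11b.Three.Koly.Method2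

/-- An automorphism `c ≠ 1` of an imaginary quadratic field is an involution (`|Aut(K/ℚ)| = [K : ℚ] = 2`). [folklore] -/
theorem mul_self_eq_one_of_ne_one (K : Type) [Field K] [NumberField K] (hK : IsImaginaryQuadratic K)
    (c : K ≃ₐ[ℚ] K) : c * c = 1 := by
  haveI : Algebra.IsQuadraticExtension ℚ K := ⟨hK.1⟩
  have hcard : Nat.card (K ≃ₐ[ℚ] K) = 2 := by rw [IsGalois.card_aut_eq_finrank, hK.1]
  haveI : Finite (K ≃ₐ[ℚ] K) := Nat.finite_of_card_ne_zero (by rw [hcard]; decide)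
  have h2 : orderOf c ∣ 2 := hcard ▸ orderOf_dvd_natCard c
  rw [← pow_two]
  exact orderOf_dvd_iff_pow_eq_one.mp h2

/-- **S2-ENGINE from the triangulation alone.** Hypothesis `hT`: at every Hoffstein–Luo A1 frame, for complex
conjugation `c ≠ 1` and the `ZMod 3`-structure of `H¹(K, E[3])`, for every level Kolyvagin system `S` and every GOOD
even NON-EMPTY level `n` carrying a non-zero class `S.κ m n`, Zhang's Lemma 8.4 (1)+(3) holds for `SelQ n` ∕
`SelRelQ n (baseLocusQ S.κ n)` (the engine's (A3) shape). Conclusion: the v3 stub S2-ENGINE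
`stub_inductionOfLevelSystemsAtThree` VERBATIM — a level Kolyvagin system, stub A's (A1) at the frame, and
`dim_𝔽₃ Sel₃(E/K)` odd and `≥ 3` give a non-zero Kolyvagin class `c(∏m) mod 3` of the frame with Kolyvagin-prime
support. CONDITIONAL on `hT`; nothing is booked. [cite: WZhang2014, §9 proof of Thm. 9.1 and Thm. 9.2, Lemma 8.4] -/
theorem inductionOfLevelSystems_of_triangulation
    (hT : ∀ (W : WeierstrassCurve ℚ) [W.IsElliptic] [W.IsGloballyMinimal] [NeZero (W.conductorNorm ℤ)] (K : Type)
      [Field K] [NumberField K] (Dt : ModularParametrizationData W (W.conductorNorm ℤ)) (β : ℤ) (ι : K →+* ℂ),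
      Summit.BirchSwinnertonDyer.Rank1Residual.ClassX11b W 3 → W.HasMultiplicativeReductionAtPrime 3 →
      Rank1Residual.Surj W 3 → Rank1Residual.Ram W 3 → ¬ 3 ∣ W.tamagawaProduct → IsImaginaryQuadratic K →
      Odd (NumberField.discr K) → SatisfiesHeegnerHypothesis (W.conductorNorm ℤ) K →
      (W.quadraticTwist (NumberField.discr K : ℚ)).entireLFunction 1 ≠ 0 → NumberField.discr K ≠ -3 →
      (4 * (W.conductorNorm ℤ : ℤ)) ∣ β ^ 2 - NumberField.discr K → ¬ (3 : ℤ) ∣ Dt.c →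
      ∀ (c : K ≃ₐ[ℚ] K), c ≠ 1 → ∀ [Module (ZMod 3) (V3 W K)],
      ∀ (S : LevelKolyvaginSystem W K Dt β ι c) (n : Finset {q // IsUAdmissiblePrime W K q}),
        GoodLevel W K n → n.Nonempty → Even n.card → (∃ m, S.κ m n ≠ 0) →
        ∃ (s : Bool) (d : ℕ), finrank (ZMod 3) (SelQ W K c n s) = d + 1 ∧
          SelQ W K c n s = SelRelQ W K c n (baseLocusQ W K S.κ n) s ∧
          FiniteDimensional (ZMod 3) (SelRelQ W K c n (baseLocusQ W K S.κ n) (!s)) ∧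
          finrank (ZMod 3) (SelRelQ W K c n (baseLocusQ W K S.κ n) (!s)) ≤ d) :
    ∀ (W : WeierstrassCurve ℚ) [W.IsElliptic] [W.IsGloballyMinimal] [NeZero (W.conductorNorm ℤ)] (K : Type)
      [Field K] [NumberField K] (Dt : ModularParametrizationData W (W.conductorNorm ℤ)) (β : ℤ) (ι : K →+* ℂ),
      Summit.BirchSwinnertonDyer.Rank1Residual.ClassX11b W 3 → W.HasMultiplicativeReductionAtPrime 3 →
      Rank1Residual.Surj W 3 → Rank1Residual.Ram W 3 → ¬ 3 ∣ W.tamagawaProduct → IsImaginaryQuadratic K →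
      Odd (NumberField.discr K) → SatisfiesHeegnerHypothesis (W.conductorNorm ℤ) K →
      (W.quadraticTwist (NumberField.discr K : ℚ)).entireLFunction 1 ≠ 0 → NumberField.discr K ≠ -3 →
      (4 * (W.conductorNorm ℤ : ℤ)) ∣ β ^ 2 - NumberField.discr K → ¬ (3 : ℤ) ∣ Dt.c →
      ∀ (c : K ≃ₐ[ℚ] K), c ≠ 1 → ∀ [Module (ZMod 3) (V3 W K)],
      LevelKolyvaginSystem W K Dt β ι c →
      -- (A1) at the frame (stub A's body, verbatim) as HYPOTHESIS
      (∀ (n : Finset {q // IsUAdmissiblePrime W K q}) (μ : Bool) (x : V3 W K),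
        GoodLevel W K n → x ∈ SelQ W K c n μ → x ≠ 0 →
        ∃ q : {q // IsUAdmissiblePrime W K q}, q ∉ n ∧ GoodLevel W K (insert q n) ∧
          x ∉ SelQ W K c (insert q n) μ ∧
          SelQ W K c (insert q n) μ ≤ SelQ W K c n μ ∧
          finrank (ZMod 3) (SelQ W K c (insert q n) μ) + 1 = finrank (ZMod 3) (SelQ W K c n μ) ∧
          SelQ W K c (insert q n) (!μ) = SelQ W K c n (!μ)) →
      Odd (finrank (ZMod 3)
        (AddSubgroup.toZModSubmodule 3 (selmerGroup (W.baseChange K) ((3 ^ 1 : ℕ) : ℤ)))) →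
      3 ≤ finrank (ZMod 3)
        (AddSubgroup.toZModSubmodule 3 (selmerGroup (W.baseChange K) ((3 ^ 1 : ℕ) : ℤ))) →
      ∃ (n : ℕ) (d : KolyvaginHeegnerData Dt β ι n),
        KolyvaginDescent.KolSupp (Zhang2014.IsKolyvaginPrime (W.conductorNorm ℤ) W K 3) n ∧
          d.kolyvaginClass Nat.prime_three 1 ≠ 0 := by
  intro W _ _ _ K _ _ Dt β ι hX hmult hsurj hram htam hK hodd hH hLt h3 hβ hc c hc1 _ S hA1 hPar h3le
  have hcc : c * c = 1 := mul_self_eq_one_of_ne_one K hK c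
  have hT' := hT W K Dt β ι hX hmult hsurj hram htam hK hodd hH hLt h3 hβ hc c hc1 S
  -- parity and the rank bound in `SelQ ∅` currency
  have hPar' := hPar
  rw [finrank_selmer_eq_finrank_selQ_add W K hK c hcc] at hPar'
  have h1' : finrank (ZMod 3) (SelQ W K c ∅ true) + finrank (ZMod 3) (SelQ W K c ∅ false) ≠ 1 := by
    rw [← finrank_selmer_eq_finrank_selQ_add W K hK c hcc]
    omega
  -- (A2) = the system's transport (the engine's extra `Even` binder is dropped)
  have hA2' : ∀ (n : Finset {q // IsUAdmissiblePrime W K q}) (q₁ q₂ : {q // IsUAdmissiblePrime W K q}),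
      GoodLevel W K n → Even n.card → GoodLevel W K (insert q₁ n) → GoodLevel W K (insert q₂ (insert q₁ n)) →
      q₁ ∉ n → q₂ ∉ insert q₁ n → q₂ ∉ baseLocusQ W K S.κ (insert q₂ (insert q₁ n)) → ∃ m, S.κ m n ≠ 0 :=
    fun n q₁ q₂ hg _ hg₁ hg₂ hq₁ hq₂ hB ↦ S.transport n q₁ q₂ hg hg₁ hg₂ hq₁ hq₂ hB
  -- (A3) at non-empty good even levels = the triangulation hypothesis
  have hA3' : ∀ (n : Finset {q // IsUAdmissiblePrime W K q}), GoodLevel W K n → n.Nonempty → Even n.card →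
      (∃ m, S.κ m n ≠ 0) →
      ∃ (s : Bool) (d : ℕ), finrank (ZMod 3) (SelQ W K c n s) = d + 1 ∧
        SelQ W K c n s = SelRelQ W K c n (baseLocusQ W K S.κ n) s ∧
        FiniteDimensional (ZMod 3) (SelRelQ W K c n (baseLocusQ W K S.κ n) (!s)) ∧
        finrank (ZMod 3) (SelRelQ W K c n (baseLocusQ W K S.κ n) (!s)) ≤ d :=
    fun n hg hne hev htrig ↦ hT' n hg hne hev htrig
  -- (A4) relaxation is definitional
  have hA4' : ∀ (n : Finset {q // IsUAdmissiblePrime W K q}) (q : {q // IsUAdmissiblePrime W K q})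
      (T : Set {q // IsUAdmissiblePrime W K q}) (s : Bool), GoodLevel W K n → GoodLevel W K (insert q n) →
      q ∉ n → q ∈ T → SelQ W K c n s ≤ SelRelQ W K c (insert q n) T s :=
    fun n q T s _ _ hqn hqT ↦ relaxation_le W K c n q T s hqn hqT
  -- (A5): vacuous at the bottom (rank ≥ 3), the system's base case above it
  have hA5' : ∀ (n : Finset {q // IsUAdmissiblePrime W K q}), GoodLevel W K n → Even n.card →
      finrank (ZMod 3) (SelQ W K c n true) + finrank (ZMod 3) (SelQ W K c n false) = 1 → S.κ ∅ n ≠ 0 := by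
    intro n hg hev hr
    by_cases hn : n = ∅
    · subst hn
      exact absurd hr h1'
    · exact S.baseCase n hg (Finset.nonempty_iff_ne_empty.mpr hn) hev hr
  obtain ⟨m, hm⟩ :=
    Summit.BirchSwinnertonDyer.Rank1Residual.X11b.Three.Koly.ZhangInductionOnPosOddStart.exists_ne_zero_at_bottom_of_zhangInduction_on_pos_oddStart
      (GoodLevel W K) (goodLevel_empty W K) (SelQ W K c) (SelRelQ W K c) (baseLocusQ W K S.κ) S.κ ∅ hA1 hA2' hA3'
      hA4' hA5' hPar'
  obtain ⟨d, hd⟩ := S.realisation m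
  exact ⟨∏ ℓ ∈ m, (ℓ : ℕ), d, Method2TowerCut.kolSupp_prod m (fun ℓ _ ↦ ℓ.2.1), fun h0 ↦ hm (by rw [hd, h0])⟩

end Summit.BirchSwinnertonDyer.Rank1Residual.X11b.Three.Koly.Method2EngineOfTriangulation

end
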